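import Summits.KontsevichZagierPeriods.Zeta5Search.LaiSweepShard

/-!
# `κ₃` sweep certificate — shard file 102 of 127 (shards 714–720 of 889)

HONEST FRAMING. Systematic search; no irrationality claim unless certified. This file only checks,
by `decide +kernel`, shards 714–720 of the order-cell sweep of the `κ₃` point `(74, 2180, 444; δ74)`
(engine `LaiSweepEngine`, soundness `LaiSweepJump/Free/Eval/Shard/Kappa3`; a shard is `⟨regime, n,
p, q, p', q', Lo, Up⟩`: `n` cells from `p/q` to `p'/q'` with integer rate sums in `[Lo, Up]`, `K =
128`, `D = 2^40`). It draws NO conclusion: only the capstone `LaiKappa3SweepCert`, which needs all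
127 shard files, does. Kernel cost of this file ≈ 560 cells × 0.3 s.
-/

namespace Summit.KontsevichZagierPeriods.Zeta5Search.Sweep

set_option maxHeartbeats 100000000 in
/-- Shard 714: 80 cells of regime B from `341/437` to `161/206`.
[cite: Lai2024BallRivoal, §4 Lemma 4.3] -/
theorem shard714 :
    Shard.check 128 (2^40)
      ⟨true, 80, 341, 437, 161, 206, 11079096119675, 16950469268851⟩ = true := by
  decide +kernel

set_option maxHeartbeats 100000000 in
/-- Shard 715: 80 cells of regime B from `161/206` to `292/373`.
[cite: Lai2024BallRivoal, §4 Lemma 4.3] -/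
theorem shard715 :
    Shard.check 128 (2^40)
      ⟨true, 80, 161, 206, 292, 373, 11561198343913, 17706781914453⟩ = true := by
  decide +kernel

set_option maxHeartbeats 100000000 in
/-- Shard 716: 80 cells of regime B from `292/373` to `316/403`.
[cite: Lai2024BallRivoal, §4 Lemma 4.3] -/
theorem shard716 :
    Shard.check 128 (2^40)
      ⟨true, 80, 292, 373, 316, 403, 11457840556419, 17567294280014⟩ = true := by
  decide +kernel

set_option maxHeartbeats 100000000 in
/-- Shard 717: 80 cells of regime B from `316/403` to `150/191`.
[cite: Lai2024BallRivoal, §4 Lemma 4.3] -/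
theorem shard717 :
    Shard.check 128 (2^40)
      ⟨true, 80, 316, 403, 150, 191, 10942924693483, 16795349856666⟩ = true := by
  decide +kernel

set_option maxHeartbeats 100000000 in
/-- Shard 718: 80 cells of regime B from `150/191` to `247/314`.
[cite: Lai2024BallRivoal, §4 Lemma 4.3] -/
theorem shard718 :
    Shard.check 128 (2^40)
      ⟨true, 80, 150, 191, 247, 314, 11492780638065, 17657932572432⟩ = true := by
  decide +kernel

set_option maxHeartbeats 100000000 in
/-- Shard 719: 80 cells of regime B from `247/314` to `327/415`.
[cite: Lai2024BallRivoal, §4 Lemma 4.3] -/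
theorem shard719 :
    Shard.check 128 (2^40)
      ⟨true, 80, 247, 314, 327, 415, 11874663140207, 18264528198676⟩ = true := by
  decide +kernel

set_option maxHeartbeats 100000000 in
/-- Shard 720: 80 cells of regime B from `327/415` to `247/313`.
[cite: Lai2024BallRivoal, §4 Lemma 4.3] -/
theorem shard720 :
    Shard.check 128 (2^40)
      ⟨true, 80, 327, 415, 247, 313, 10589792779201, 16305354970473⟩ = true := by
  decide +kernel

/-- The checked shards of this file, in order. [folklore] -/
def shards102 : List (CheckedShard 128 (2^40)) :=
  [⟨_, shard714⟩, ⟨_, shard715⟩, ⟨_, shard716⟩, ⟨_, shard717⟩, ⟨_, shard718⟩,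
    ⟨_, shard719⟩, ⟨_, shard720⟩]

end Summit.KontsevichZagierPeriods.Zeta5Search.Sweep
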